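import Mathlib
import Summits.MatrixMultiplication.Statement
import Literature.AlgebraicGeometry.Hironaka2017.NearPointHilbertDomination
import Literature.AlgebraicGeometry.Resolution.Hironaka1970RationalNearPointCylinder
import Summits.MatrixMultiplication.MatrixMultiplication.Theorems.GraphEquationsExponentOne
import Summits.MatrixMultiplication.MatrixMultiplication.Theorems.GraphEquationsSquaredSystems
import Summits.MatrixMultiplication.MatrixMultiplication.Theorems.GraphEquationsRowCriterion

/-!
# GraphEquations — preliminaries for exponent descent

Decomp-mm node «GraphEquations» (lens 5); attacked crux `MultiplicityReduction` (item
stmt-MatrixMultiplication-27806), registered line `Cruxes/MultiplicityReduction/Lines/birth.lean`.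
The lemmas below serve `Theorems/GraphEquationsExponentDescent.lean` (THEOREM ED, the stub
`stub_exponentDescent`); text lens-5 g98 (typing packets g95–g97), first elaborated g122.

* L5 `vanishingIdeal_eq_graphIdeal`      — `𝕀(W_n) = (f_q)_q` as an equality of ideals;
* L3 `taylor_mod_sq`                     — `t ≡ Σ_q (∂t/∂c_q) · f_q  (mod I²)` for `t ∈ I`;
* L4 `EqSystem.mem_juxt_tests`           — the tests of a juxtaposition, both directions;
* L6 `EqSystem.ker_jacobianC_trim`       — trimming keeps `ker J_C(E)(x)` for every `x`;
* `pderiv_inr_generator'` (E-a on the folded `generator`) and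
  `EqSystem.jacobianC_mulVec_eq_zero_iff_tests` (the pattern of
  `jacobianC_graphPoint_mulVec_eq_zero_iff` at a general point).
-/

set_option linter.dupNamespace false

namespace Summit.MatrixMultiplication.MatrixMultiplication.Theorems.GraphEquations

open MvPolynomial
open Literature.AlgebraicGeometry.Hironaka2017.EdgeAlgebra (isHomogeneous_aeval_linear
  homogeneousComponent_aeval_linear)
open Literature.AlgebraicGeometry.Resolution (homogeneousComponent_eq_zero_of_mem_pow_idealOfVars
  mem_pow_idealOfVars_of_isHomogeneous)

variable {n : ℕ}

/-! ## L5 (S0): the vanishing ideal of the graph is the graph ideal -/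

/-- **L5.**  `𝕀(W_n) = I = (f_q)_q`: the graph Nullstellensatz (`mem_graphIdeal_of_vanishing`,
GraphEquationsOrderObstruction l.149) and `f_q ∈ 𝕀(W_n)` (`generator_mem_vanishingIdeal`,
GraphEquationsExponentOne l.28) packaged as an equality of ideals. -/
theorem vanishingIdeal_eq_graphIdeal (n : ℕ) :
    MvPolynomial.vanishingIdeal ℂ (mmGraph n) = graphIdeal n := by
  refine le_antisymm (fun t ht => ?_) (Ideal.span_le.2 ?_)
  · -- `t` vanishes on `W_n`, hence lies in `I` (M9b).
    refine mem_graphIdeal_of_vanishing fun y hy => ?_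
    simpa [MvPolynomial.coe_aeval_eq_eval] using (MvPolynomial.mem_vanishingIdeal_iff.1 ht) y hy
  · -- each generator vanishes on `W_n`.
    rintro _ ⟨⟨i, l⟩, rfl⟩
    -- `generator n (i, l)` unfolds by `rfl` to the displayed polynomial of
    -- `generator_mem_vanishingIdeal i l`; fallback `simpa [generator] using …`.
    exact generator_mem_vanishingIdeal i l

/-! ## L3 (S4 (c3)): Taylor's formula modulo `I²` in the `C`-directions -/

/-- E-a on the folded generator: `∂ f_q / ∂ c_p = [p = q]`
(`pderiv_inr_generator`, GraphEquationsExponentOne l.44, is stated on the unfolded polynomial). -/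
theorem pderiv_inr_generator' (p q : Fin n × Fin n) :
    MvPolynomial.pderiv (Sum.inr p) (generator n q) = if p = q then 1 else 0 := by
  obtain ⟨i, l⟩ := q
  -- defeq unfolding of `generator n (i, l)`; fallback `unfold generator; exact …` or
  -- `simpa [generator] using pderiv_inr_generator p i l`.
  exact pderiv_inr_generator p i l

/-- **L3 (Taylor mod `I²`).**  For `t ∈ I = (f_q)_q`:
`t - Σ_q (∂t/∂c_q) · f_q ∈ I²`.
Proof: write `t = Σ_q h_q f_q` (`Ideal.mem_span_range_iff_exists_fun`); by Leibniz and E-a,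
`∂_p t = Σ_q (∂_p h_q) f_q + h_p`, so `t - Σ_p (∂_p t) f_p = -Σ_p (Σ_q (∂_p h_q) f_q) f_p ∈ I·I`. -/
theorem taylor_mod_sq {t : MvPolynomial (GraphVars n) ℂ} (ht : t ∈ graphIdeal n) :
    t - ∑ q : Fin n × Fin n, MvPolynomial.pderiv (Sum.inr q) t * generator n q ∈
      graphIdeal n ^ 2 := by
  have ht' : t ∈ Ideal.span (Set.range (generator n)) := ht
  obtain ⟨h, rfl⟩ := Ideal.mem_span_range_iff_exists_fun.1 ht'
  -- `∂_p (Σ_q h_q f_q) = Σ_q (∂_p h_q) f_q + h_p`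
  have hR : ∀ p : Fin n × Fin n,
      MvPolynomial.pderiv (Sum.inr p) (∑ q, h q * generator n q) =
        (∑ q, MvPolynomial.pderiv (Sum.inr p) (h q) * generator n q) + h p := by
    intro p
    rw [map_sum]
    -- one `simp only`; fallback
    -- `simp_rw [MvPolynomial.pderiv_mul, pderiv_inr_generator', mul_ite, mul_one, mul_zero]`
    -- `rw [Finset.sum_add_distrib, Finset.sum_ite_eq, if_pos (Finset.mem_univ p)]`.
    simp only [MvPolynomial.pderiv_mul, pderiv_inr_generator', mul_ite, mul_one, mul_zero,
      Finset.sum_add_distrib, Finset.sum_ite_eq, Finset.mem_univ, if_true]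
  -- closed form of the Taylor remainder
  have hcalc : (∑ q, h q * generator n q) -
      ∑ p, MvPolynomial.pderiv (Sum.inr p) (∑ q, h q * generator n q) * generator n p =
      -(∑ p, (∑ q, MvPolynomial.pderiv (Sum.inr p) (h q) * generator n q) * generator n p) := by
    simp_rw [hR, add_mul]
    rw [Finset.sum_add_distrib]
    ring
  rw [hcalc, Ideal.neg_mem_iff, pow_two]
  refine Ideal.sum_mem _ fun p _ => Ideal.mul_mem_mul (Ideal.sum_mem _ fun q _ => ?_)
    (generator_mem_graphIdeal p)
  exact Ideal.mul_mem_left _ _ (generator_mem_graphIdeal q)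

namespace EqSystem

/-! ## L4 (S3 (b5)): the tests of a juxtaposition -/

/-- **L4.**  `i` is a test index of `E.juxt F` iff it is a test index of `E` or a shifted test
index of `F` (`juxt`, GraphEquationsRowCriterion l.159; the two introduction halves are
`mem_juxt_tests_left/right`, l.195 / l.199 — only the elimination direction is new). -/
theorem mem_juxt_tests {E F : EqSystem n} {i : ℕ} :
    i ∈ (E.juxt F).tests ↔ i ∈ E.tests ∨ ∃ i' ∈ F.tests, i = i' + E.cost := by
  constructor
  · intro h
    have h' : i ∈ E.tests ++ F.tests.map (· + E.cost) := h
    rcases List.mem_append.mp h' with h₁ | h₂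
    · exact Or.inl h₁
    · obtain ⟨i', hi', rfl⟩ := List.mem_map.mp h₂
      exact Or.inr ⟨i', hi', rfl⟩
  · rintro (h | ⟨i', hi', rfl⟩)
    · exact mem_juxt_tests_left h
    · exact mem_juxt_tests_right hi'

/-! ## L6 (S3 (b6)): trimming keeps the kernel of the `C`-Jacobian -/

/-- `J_C(E)(x) · δ = 0` read test by test: `Σ_q (∂t_j/∂c_q)(x) δ_q = 0` for every listed `j`
(pattern of `jacobianC_graphPoint_mulVec_eq_zero_iff`, GraphEquationsTangentDeflation l.95, at an
arbitrary point `x`). -/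
theorem jacobianC_mulVec_eq_zero_iff_tests (E : EqSystem n) (x : GraphVars n → ℂ)
    (δ : Fin n × Fin n → ℂ) :
    (E.jacobianC x).mulVec δ = 0 ↔
      ∀ j ∈ E.tests,
        ∑ q : Fin n × Fin n,
          MvPolynomial.eval x (MvPolynomial.pderiv (Sum.inr q) (E.testPoly j)) * δ q = 0 := by
  constructor
  · intro h j hj
    obtain ⟨o, ho⟩ := List.mem_iff_get.mp hj
    have h' := congr_fun h o
    rw [← ho]
    simpa [Matrix.mulVec, dotProduct, jacobianC] using h'
  · intro h
    funext o
    have h' := h _ (List.get_mem E.tests o)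
    simpa [Matrix.mulVec, dotProduct, jacobianC] using h'

/-- **L6.**  `ker J_C(E.trim)(x) = ker J_C(E)(x)`: `E.trim` keeps the circuit and every in-range
test (`trim_testPoly`, `mem_trim_tests`, GraphEquationsSquaredSystems l.56 / l.59) and drops only
duplicates and out-of-range indices, whose test polynomial is `0` (`testPoly_eq_zero_of_le`,
l.67), i.e. zero rows.  Consequence used in S3 (b6): same rank / corank at every `x`. -/
theorem ker_jacobianC_trim (E : EqSystem n) (x : GraphVars n → ℂ) :
    LinearMap.ker (E.trim.jacobianC x).mulVecLin = LinearMap.ker (E.jacobianC x).mulVecLin := by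
  ext δ
  simp only [LinearMap.mem_ker, Matrix.mulVecLin_apply]
  rw [jacobianC_mulVec_eq_zero_iff_tests, jacobianC_mulVec_eq_zero_iff_tests]
  constructor
  · intro h j hj
    by_cases hjc : j < E.cost
    · -- `E.trim.testPoly j = E.testPoly j` is `rfl` (`trim_testPoly`); fallback
      -- `simpa only [trim_testPoly] using h j (mem_trim_tests.mpr ⟨hj, hjc⟩)`.
      exact h j (mem_trim_tests.mpr ⟨hj, hjc⟩)
    · -- out-of-range test: zero polynomial, zero row.
      simp [testPoly_eq_zero_of_le (not_lt.mp hjc)]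
  · intro h j hj
    exact h j (mem_trim_tests.mp hj).1

end EqSystem

end Summit.MatrixMultiplication.MatrixMultiplication.Theorems.GraphEquations
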